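import Literature.Barriers.HodgeConjecture.DecompositionOfTheDiagonalDegreeFourHolds
import Literature.AlgebraicGeometry.HodgeTheory.HardLefschetzNFoldHolds
import Literature.AlgebraicGeometry.HodgeTheory.LefschetzOneOneHolds
import Literature.AlgebraicGeometry.HodgeTheory.ComplexConjugationHolds
import Literature.AlgebraicGeometry.HodgeTheory.HodgeConjecture
import HarnessLib

/-!
# The Hodge conjecture for fivefolds with `CH₀` supported in dimension `≤ 3` (Bloch–Srinivas 1983; Arapura 2005) — PROVED

Layer `Literature/AlgebraicGeometry/HodgeTheory`. A smooth projective complex FIVEFOLD `X` whose group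
of `0`-cycles is supported on a closed algebraic subset of dimension `≤ 3` — in particular every
rationally connected, hence every Fano, fivefold (`CH₀(X) = ℤ`, supported on a point; a merely UNIRULED
fivefold only has `CH₀` supported in dimension `≤ 4`, which is not enough here, unlike the fourfold case
of Conte–Murre) — satisfies the Hodge conjecture in every degree:

* codimension `0`: `algebraicClasses X 0 = ⊤`;
* codimension `1`: the Lefschetz theorem on `(1,1)`-classes (`lefschetzOneOne_rational_holds`);
* codimension `2`: Bloch–Srinivas 1983, Thm. 1 (3) / Voisin II Prop. 10.26 — PROVED in the tree as
  `Literature.Barriers.HodgeConjecture.BlochSrinivas1983_hodgeConjectureDegreeFour_of_chowZeroSupported_holds`;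
* codimension `p ≥ 3` (`5 < 2p`): hard Lefschetz transports codimension `5 - p ≤ 2` to codimension `p`
  (`HardLefschetzNFold.mem_algebraicClasses_of_lt_holds`, Voisin I Thm. 6.25 / Kerr–Pearlstein §3.1);
* Hodge models exist (`nonempty_hodgeModel_holds`).

This is the rationally-connected case of D. Arapura, *The Hodge conjecture for rationally connected
fivefolds*, arXiv:math/0502257 (2005), Thm. 1 ("Let `X` be a smooth projective five dimensional variety
over `ℂ`, such that the base of the maximal rationally connected fibration is at most three dimensional.
Then the Hodge conjecture holds for `X`"; Cor. 2: "The Hodge conjecture holds for a Fano fivefold"),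
whose author notes that "the road taken here has been well travelled. The papers of Bloch–Srinivas,
Esnault–Levine, Fakhruddin–Rajan – especially the first – contain a number of related ideas". The
general case of Arapura's Thm. 1 (MRC base of dimension `≤ 3`, relative decomposition of the diagonal)
is NOT formalised here. No new definition, no named fact, no sorry.

## References

* [BlochSrinivas1983] S. Bloch, V. Srinivas, Remarks on correspondences and algebraic cycles, Amer. J.
  Math. 105 (1983) 1235–1253, Thm. 1 (3).
* [VoisinHodgeII2003] C. Voisin, Hodge Theory and Complex Algebraic Geometry II, Prop. 10.26.
* [Arapura2005RCFivefolds] D. Arapura, The Hodge conjecture for rationally connected fivefolds,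
  arXiv:math/0502257, Thm. 1 and Cor. 2.
* [VoisinHodgeI2002] C. Voisin, Hodge Theory and Complex Algebraic Geometry I, Thm. 6.25, Thm. 11.30.
* [KerrPearlstein2011] M. Kerr, G. Pearlstein, An exponential history of functions with logarithmic
  growth, §3.1.
-/

noncomputable section

namespace Literature.AlgebraicGeometry.HodgeTheory

open Literature.Barriers.HodgeConjecture

variable {X : Motives.SchemeOver ℂ}

/-- **Codimension `≤ 2` on a smooth projective variety with `CH₀` supported in dimension `≤ 3`**
(any dimension `n`): rational `(q,q)`-classes are algebraic for `q = 0` (everything), `q = 1`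
(Lefschetz `(1,1)`), `q = 2` (Bloch–Srinivas 1983 / Voisin II Prop. 10.26, proved in the tree).
[cite: VoisinHodgeII2003, Prop. 10.26] [cite: BlochSrinivas1983, Thm. 1 (3)]
[cite: VoisinHodgeI2002, Thm. 11.30] -/
theorem mem_algebraicClasses_of_le_two_of_hasChowZeroSupportedInDimLE {n : ℕ}
    (hX : Motives.IsSmoothProjective n X) {d : ℕ} (hd : d ≤ 3) (hW : HasChowZeroSupportedInDimLE X d)
    (q : ℕ) (hq : q ≤ 2) (c : complexBetti X (2 * q)) (hc : IsRationalClass c)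
    (hh : IsOfHodgeType n X (2 * q) q q c) : c ∈ algebraicClasses X q := by
  interval_cases q
  · rw [algebraicClasses_zero]
    exact Submodule.mem_top
  · exact lefschetzOneOne_rational_holds hX c hc hh
  · exact BlochSrinivas1983_hodgeConjectureDegreeFour_of_chowZeroSupported.of_le
      BlochSrinivas1983_hodgeConjectureDegreeFour_of_chowZeroSupported_holds hX hd hW c hc hh

/-- **The Hodge conjecture for smooth projective complex fivefolds with `CH₀` supported in dimension
`≤ 3`** (Bloch–Srinivas in codimension `2`, Lefschetz `(1,1)` in codimension `1`, hard Lefschetz for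
codimension `≥ 3`) — the rationally connected / Fano case of Arapura's theorem, unconditionally.
[cite: Arapura2005RCFivefolds, Thm. 1 and Cor. 2] [cite: BlochSrinivas1983, Thm. 1 (3)]
[cite: VoisinHodgeII2003, Prop. 10.26] [cite: VoisinHodgeI2002, Thm. 6.25] -/
theorem hodgeConjectureFor_five_of_hasChowZeroSupportedInDimLE
    (hX : Motives.IsSmoothProjective 5 X) {d : ℕ} (hd : d ≤ 3) (hW : HasChowZeroSupportedInDimLE X d) :
    HodgeConjectureFor 5 X := by
  refine ⟨(nonempty_hodgeModel_holds (n := 5) (X := X)).nonempty hX, fun p c hc hh ↦ ?_⟩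
  by_cases hp : p ≤ 2
  · exact mem_algebraicClasses_of_le_two_of_hasChowZeroSupportedInDimLE hX hd hW p hp c hc hh
  · exact HardLefschetzNFold.mem_algebraicClasses_of_lt_holds hX (by omega)
      (fun c' hc' hh' ↦
        mem_algebraicClasses_of_le_two_of_hasChowZeroSupportedInDimLE hX hd hW (5 - p) (by omega) c' hc' hh')
      c hc hh

/-- **Variant with `CH₀` supported on a point** (`CH₀(X) = ℤ`: rationally connected fivefolds, Fano
fivefolds, and more generally `CH₀`-trivial fivefolds). [cite: Arapura2005RCFivefolds, Cor. 2]
[cite: BlochSrinivas1983, Thm. 1 (3)] -/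
theorem hodgeConjectureFor_five_of_hasChowZeroSupportedInDimLE_zero
    (hX : Motives.IsSmoothProjective 5 X) (hW : HasChowZeroSupportedInDimLE X 0) :
    HodgeConjectureFor 5 X :=
  hodgeConjectureFor_five_of_hasChowZeroSupportedInDimLE hX (Nat.zero_le 3) hW

/-- **Fourfolds too** (for completeness, same assembly one dimension down): a smooth projective complex
FOURFOLD with `CH₀` supported in dimension `≤ 3` — e.g. covered by rational curves (Conte–Murre 1978,
Thm. 1) — satisfies the Hodge conjecture in every degree. [cite: ConteMurre1978, Thm. 1]
[cite: VoisinHodgeII2003, Prop. 10.26] [cite: BlochSrinivas1983, Thm. 1 (3)] -/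
theorem hodgeConjectureFor_four_of_hasChowZeroSupportedInDimLE
    (hX : Motives.IsSmoothProjective 4 X) {d : ℕ} (hd : d ≤ 3) (hW : HasChowZeroSupportedInDimLE X d) :
    HodgeConjectureFor 4 X := by
  refine ⟨(nonempty_hodgeModel_holds (n := 4) (X := X)).nonempty hX, fun p c hc hh ↦ ?_⟩
  by_cases hp : p ≤ 2
  · exact mem_algebraicClasses_of_le_two_of_hasChowZeroSupportedInDimLE hX hd hW p hp c hc hh
  · exact HardLefschetzNFold.mem_algebraicClasses_of_lt_holds hX (by omega)
      (fun c' hc' hh' ↦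
        mem_algebraicClasses_of_le_two_of_hasChowZeroSupportedInDimLE hX hd hW (4 - p) (by omega) c' hc' hh')
      c hc hh

end Literature.AlgebraicGeometry.HodgeTheory

end
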